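import Literature.NumberTheory.Automorphic.LocalOrbitalIntegral
import Literature.NumberTheory.Automorphic.AdelicCommutativeDatumMultiplicityOne
import HarnessLib

/-!
# Orbital integrals on a product `G₂ × G₁` with `G₁` COMMUTATIVE are orbital integrals of the slice on `G₂`:
# `O_{(γ₂, γ₁)}^{m}(f) = O_{γ₂}^{e_* m}(f(·, γ₁))` along `(G₂ × G₁) ⧸ C(γ₂, γ₁) ≃ₜ G₂ ⧸ C(γ₂)`
(Rogawski, *Automorphic Representations of Unitary Groups in Three Variables* (1990), §4.2, §4.9 p. 54: the endoscopic group
`H = U(2) × U(1)`, `Φ(γ, f) = ∫_{G_γ∖G} f(g⁻¹γg) dg`; §7.3 p. 98 «Let `G = U(3)`, `U(2)`, or `U(2) × U(1)`»; Gelbart, *Automorphic forms on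
adele groups* (1975), (9.13), §10 p. 155 (10.19) for orbital integrals on products)

Topic `NumberTheory/Automorphic`; namespace `Literature.NumberTheory.Automorphic`. THEOREMS ONLY (no definition, no named fact, no
instance, no notation, no `sorry`). Cell `pub/hodgecm-mathlib`, ENGINE T1 (crux H413 = `stmt-HodgeConjecture-24833`), item (G1) of the H-side
KIT-DOCK census (`F0/P3a/F0P3a-p02/g7/CENSUS-HsideKitDock.F0P3a-p02g7.md`, LEAD WORD H-2): the one H-side currency lemma that is not a
twin of a `U(J₃)` file. For the endoscopic group `H(𝔸) = U(Φ₂)(𝔸) × U(Φ₁)(𝔸)` the second factor is COMMUTATIVE (★ `cmDatum_one_mul_comm`),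
so the centraliser of `(γ₂, γ₁)` is `C(γ₂) × U(Φ₁)(𝔸)`, the orbit space `H(𝔸) ⧸ C(γ₂, γ₁)` is `U(Φ₂)(𝔸) ⧸ C(γ₂)` (the slice map
`(x₂, x₁) C(γ₂,γ₁) ↦ x₂ C(γ₂)` is a homeomorphism), and the orbital integral of `f^H` at `(γ₂, γ₁)` is the orbital integral on `U(Φ₂)(𝔸)` of
the SLICE `g₂ ↦ f^H(g₂, γ₁)` — the orbital-integral companion of ★ `tsum_pair_eq_sum_kernel_slice` (`UnitaryGroupPairKernelSlices`, kernels)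
and of ★ `UnitaryGroupPairArthurTraceTwo` (Arthur's trace as a finite sum of slices). Everything is stated for an ARBITRARY pair of topological
groups `G₂`, `G₁` with `G₁` commutative (hypothesis `hcomm`, as in ★ `tsum_pair_eq_sum_tsum_slice_of_comm`), then read at the kit's carriers.

* §1 `mem_centralizer_pair_iff_of_comm`, `centralizer_pair_eq_prod_top_of_comm` — `C(γ₂, γ₁) = C(γ₂) × G₁`.
* §2 **`exists_homeomorph_quotient_centralizer_pair_of_comm`** — a homeomorphism `e : (G₂ × G₁) ⧸ C(γ₂, γ₁) ≃ₜ G₂ ⧸ C(γ₂)` with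
  `e((x₂, x₁) C) = x₂ C(γ₂)` (hence `e⁻¹(x₂ C(γ₂)) = (x₂, x₁) C` for every `x₁`, and `e` is `G₂ × G₁`-equivariant for the action through the
  first factor: `apply_smul_eq_of_forall_apply_mk` (equivariance); `e` is unique since `QuotientGroup.mk` is onto).
* §3 `descConj_pair_mk_eq_of_comm` — the orbital INTEGRAND of `f` at `(γ₂, γ₁)` is the orbital integrand of the slice, through `e`;
  **`orbitalIntegral_pair_eq_orbitalIntegral_slice_map_of_comm`** — `orbitalIntegral (γ₂, γ₁) f m = orbitalIntegral γ₂ (f(·, γ₁)) (e_* m)` for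
  EVERY measure `m` on the orbit space (no invariance, no integrability needed: a change of variables along a measurable bijection), and the
  converse reading **`orbitalIntegral_slice_eq_orbitalIntegral_pair_map_symm_of_comm`** for a measure `m₂` on `G₂ ⧸ C(γ₂)`;
  `smulInvariantMeasure_map_symm_of_comm` — invariant orbit measures on `G₂ ⧸ C(γ₂)` pull back to invariant ones.
* §4 the conjugacy classes of the product: `isConj_pair_iff_of_comm` (`(a₂,a₁) ∼ (b₂,b₁) ↔ a₂ ∼ b₂ ∧ a₁ = b₁`) and
  **`exists_equiv_conjClasses_prod_of_comm`** — `ConjClasses (G₂ × G₁) ≃ ConjClasses G₂ × G₁` over `ConjClasses.mk`.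
* §5 the kit's carriers: `orbitalIntegral_pair_eq_orbitalIntegral_slice_map_cmDatum_one` on `(cmDatum L N H₂).Adelic × (cmDatum L 1 H₁).Adelic`
  (★ `cmDatum_one_mul_comm`).

## References
* [Rogawski1990] J. D. Rogawski, *Automorphic Representations of Unitary Groups in Three Variables*, Ann. of Math. Stud. 123 (1990), §4.2, §4.9
  p. 54, §7.3 p. 98.
* [Gelbart1975] S. Gelbart, *Automorphic forms on adele groups*, Ann. of Math. Stud. 83 (1975), (9.13), §10 p. 155 (10.19).
-/

set_option autoImplicit false

noncomputable section

open MeasureTheory Measure Set Topology NumberField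
open Literature.MeasureTheory.Group
open scoped ENNReal NNReal

namespace Literature.NumberTheory.Automorphic

/-! ## §1 The centraliser of `(γ₂, γ₁)` when `G₁` is commutative -/

section Centralizer

variable {G₂ G₁ : Type*} [Group G₂] [Group G₁]

/-- **`(x₂, x₁) ∈ C(γ₂, γ₁) ↔ x₂ ∈ C(γ₂)`** when `G₁` is commutative. [cite: Rogawski1990, §4.2] -/
theorem mem_centralizer_pair_iff_of_comm (hcomm : ∀ a b : G₁, a * b = b * a) (γ₂ : G₂) (γ₁ : G₁) (p : G₂ × G₁) :
    p ∈ Subgroup.centralizer ({(γ₂, γ₁)} : Set (G₂ × G₁)) ↔ p.1 ∈ Subgroup.centralizer ({γ₂} : Set G₂) := by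
  simp only [Subgroup.mem_centralizer_singleton_iff, Prod.ext_iff, Prod.fst_mul, Prod.snd_mul]
  exact ⟨fun h => h.1, fun h => ⟨h, hcomm _ _⟩⟩

/-- **`C(γ₂, γ₁) = C(γ₂) × G₁`** when `G₁` is commutative. [cite: Rogawski1990, §4.2] -/
theorem centralizer_pair_eq_prod_top_of_comm (hcomm : ∀ a b : G₁, a * b = b * a) (γ₂ : G₂) (γ₁ : G₁) :
    Subgroup.centralizer ({(γ₂, γ₁)} : Set (G₂ × G₁)) = (Subgroup.centralizer ({γ₂} : Set G₂)).prod ⊤ := by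
  ext p
  rw [mem_centralizer_pair_iff_of_comm hcomm, Subgroup.mem_prod]
  exact ⟨fun h => ⟨h, Subgroup.mem_top _⟩, fun h => h.1⟩

/-- The left-coset relations match along the first projection: `(x₂,x₁)⁻¹ (y₂,y₁) ∈ C(γ₂,γ₁) ↔ x₂⁻¹ y₂ ∈ C(γ₂)`. [cite: Rogawski1990, §4.2] -/
theorem leftRel_centralizer_pair_iff_of_comm (hcomm : ∀ a b : G₁, a * b = b * a) (γ₂ : G₂) (γ₁ : G₁) (x y : G₂ × G₁) :
    QuotientGroup.leftRel (Subgroup.centralizer ({(γ₂, γ₁)} : Set (G₂ × G₁))) x y ↔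
      QuotientGroup.leftRel (Subgroup.centralizer ({γ₂} : Set G₂)) x.1 y.1 := by
  rw [QuotientGroup.leftRel_apply, QuotientGroup.leftRel_apply, mem_centralizer_pair_iff_of_comm hcomm]
  rfl

end Centralizer

/-! ## §2 The slice homeomorphism `(G₂ × G₁) ⧸ C(γ₂, γ₁) ≃ₜ G₂ ⧸ C(γ₂)` -/

section Slice

variable {G₂ G₁ : Type*} [Group G₂] [Group G₁] [TopologicalSpace G₂] [TopologicalSpace G₁]

/-- **THE SLICE HOMEOMORPHISM**: for `G₁` commutative there is a homeomorphism `e : (G₂ × G₁) ⧸ C(γ₂, γ₁) ≃ₜ G₂ ⧸ C(γ₂)` with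
`e((x₂, x₁) C(γ₂, γ₁)) = x₂ C(γ₂)` (first projection on representatives; the inverse is `x₂ C(γ₂) ↦ (x₂, 1) C(γ₂, γ₁)`; both maps are
continuous for the quotient topologies). [cite: Rogawski1990, §4.2; §4.9 p. 54] -/
theorem exists_homeomorph_quotient_centralizer_pair_of_comm (hcomm : ∀ a b : G₁, a * b = b * a) (γ₂ : G₂) (γ₁ : G₁) :
    ∃ e : (G₂ × G₁) ⧸ Subgroup.centralizer ({(γ₂, γ₁)} : Set (G₂ × G₁)) ≃ₜ G₂ ⧸ Subgroup.centralizer ({γ₂} : Set G₂),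
      ∀ x : G₂ × G₁, e (QuotientGroup.mk x) = QuotientGroup.mk x.1 := by
  -- the two maps on representatives respect the coset relations
  have H₁ : ∀ x y : G₂ × G₁, QuotientGroup.leftRel (Subgroup.centralizer ({(γ₂, γ₁)} : Set (G₂ × G₁))) x y →
      QuotientGroup.leftRel (Subgroup.centralizer ({γ₂} : Set G₂)) x.1 y.1 :=
    fun x y h => (leftRel_centralizer_pair_iff_of_comm hcomm γ₂ γ₁ x y).1 h
  have H₂ : ∀ a b : G₂, QuotientGroup.leftRel (Subgroup.centralizer ({γ₂} : Set G₂)) a b →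
      QuotientGroup.leftRel (Subgroup.centralizer ({(γ₂, γ₁)} : Set (G₂ × G₁))) (a, 1) (b, 1) :=
    fun a b h => (leftRel_centralizer_pair_iff_of_comm hcomm γ₂ γ₁ (a, 1) (b, 1)).2 h
  have hleft : Function.LeftInverse (Quotient.map' (fun a : G₂ => ((a, (1 : G₁)) : G₂ × G₁)) H₂ :
      G₂ ⧸ Subgroup.centralizer ({γ₂} : Set G₂) → (G₂ × G₁) ⧸ Subgroup.centralizer ({(γ₂, γ₁)} : Set (G₂ × G₁)))
      (Quotient.map' Prod.fst H₁) := by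
    intro y
    induction y using QuotientGroup.induction_on with
    | H x =>
      change (QuotientGroup.mk ((x.1, (1 : G₁)) : G₂ × G₁) : (G₂ × G₁) ⧸ Subgroup.centralizer ({(γ₂, γ₁)} : Set (G₂ × G₁))) =
        QuotientGroup.mk x
      refine Quotient.sound ((leftRel_centralizer_pair_iff_of_comm hcomm γ₂ γ₁ _ _).2 ?_)
      exact @Setoid.refl _ (QuotientGroup.leftRel (Subgroup.centralizer ({γ₂} : Set G₂))) x.1
  have hright : Function.RightInverse (Quotient.map' (fun a : G₂ => ((a, (1 : G₁)) : G₂ × G₁)) H₂ :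
      G₂ ⧸ Subgroup.centralizer ({γ₂} : Set G₂) → (G₂ × G₁) ⧸ Subgroup.centralizer ({(γ₂, γ₁)} : Set (G₂ × G₁)))
      (Quotient.map' Prod.fst H₁) := by
    intro y
    induction y using QuotientGroup.induction_on with
    | H a => rfl
  let eqv : (G₂ × G₁) ⧸ Subgroup.centralizer ({(γ₂, γ₁)} : Set (G₂ × G₁)) ≃ G₂ ⧸ Subgroup.centralizer ({γ₂} : Set G₂) :=
    ⟨Quotient.map' Prod.fst H₁, Quotient.map' (fun a : G₂ => ((a, (1 : G₁)) : G₂ × G₁)) H₂, hleft, hright⟩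
  exact ⟨⟨eqv, continuous_fst.quotient_map' H₁, (Continuous.prodMk_left (1 : G₁)).quotient_map' H₂⟩, fun x => rfl⟩

/-- The inverse of a slice map on representatives: `e⁻¹(x₂ C(γ₂)) = (x₂, x₁) C(γ₂, γ₁)` for EVERY `x₁ ∈ G₁`. [cite: Rogawski1990, §4.2] -/
theorem symm_apply_mk_eq_of_forall_apply_mk (γ₂ : G₂) (γ₁ : G₁)
    (e : (G₂ × G₁) ⧸ Subgroup.centralizer ({(γ₂, γ₁)} : Set (G₂ × G₁)) ≃ₜ G₂ ⧸ Subgroup.centralizer ({γ₂} : Set G₂))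
    (he : ∀ x : G₂ × G₁, e (QuotientGroup.mk x) = QuotientGroup.mk x.1) (x₂ : G₂) (x₁ : G₁) :
    e.symm (QuotientGroup.mk x₂) = QuotientGroup.mk (x₂, x₁) := by
  rw [Homeomorph.symm_apply_eq, he]

/-- **Equivariance of the slice map** for the action of `G₂ × G₁` on `G₂ ⧸ C(γ₂)` through the first factor:
`e((g₂, g₁) • y) = g₂ • e(y)`. [cite: Rogawski1990, §4.2] -/
theorem apply_smul_eq_of_forall_apply_mk (γ₂ : G₂) (γ₁ : G₁)
    (e : (G₂ × G₁) ⧸ Subgroup.centralizer ({(γ₂, γ₁)} : Set (G₂ × G₁)) ≃ₜ G₂ ⧸ Subgroup.centralizer ({γ₂} : Set G₂))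
    (he : ∀ x : G₂ × G₁, e (QuotientGroup.mk x) = QuotientGroup.mk x.1) (g : G₂ × G₁)
    (y : (G₂ × G₁) ⧸ Subgroup.centralizer ({(γ₂, γ₁)} : Set (G₂ × G₁))) :
    e (g • y) = g.1 • e y := by
  induction y using QuotientGroup.induction_on with
  | H x =>
    rw [MulAction.Quotient.smul_coe, he, he, MulAction.Quotient.smul_coe]
    rfl

end Slice

/-! ## §3 The orbital integral at `(γ₂, γ₁)` is the orbital integral of the slice -/

section Orbital

variable {G₂ G₁ : Type*} [Group G₂] [Group G₁] [TopologicalSpace G₂] [TopologicalSpace G₁]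

omit [TopologicalSpace G₂] [TopologicalSpace G₁] in
/-- **The orbital integrand of `f` at `(γ₂, γ₁)` is the orbital integrand of the slice `f(·, γ₁)` at `γ₂`**:
`f((x₂,x₁)(γ₂,γ₁)(x₂,x₁)⁻¹) = f(x₂γ₂x₂⁻¹, γ₁)` (`x₁γ₁x₁⁻¹ = γ₁` in the commutative `G₁`). [cite: Rogawski1990, §4.9 p. 54] -/
theorem descConj_pair_mk_eq_of_comm {α : Type*} (hcomm : ∀ a b : G₁, a * b = b * a) (γ₂ : G₂) (γ₁ : G₁) (f : G₂ × G₁ → α)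
    (x : G₂ × G₁) :
    descConj (γ₂, γ₁) (Subgroup.centralizer ({(γ₂, γ₁)} : Set (G₂ × G₁))) (fun _ hg => Subgroup.mem_centralizer_singleton_iff.1 hg) f
        (QuotientGroup.mk x) =
      descConj γ₂ (Subgroup.centralizer ({γ₂} : Set G₂)) (fun _ hg => Subgroup.mem_centralizer_singleton_iff.1 hg)
        (fun g₂ : G₂ => f (g₂, γ₁)) (QuotientGroup.mk x.1) := by
  rw [descConj_mk, descConj_mk, Prod.mul_def, Prod.inv_mk, Prod.mul_def]
  congr 2
  rw [hcomm x.2 γ₁, mul_inv_cancel_right]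

/-- **`O_{(γ₂, γ₁)}^{m}(f) = O_{γ₂}^{e_* m}(f(·, γ₁))` — THE SLICE FORMULA.** For topological groups `G₂`, `G₁` with `G₁` commutative,
`γ = (γ₂, γ₁)`, ANY measure `m` on the orbit space `(G₂ × G₁) ⧸ C(γ)` (Borel σ-algebras), a slice homeomorphism `e` (§2) and any
`f : G₂ × G₁ → E`: `orbitalIntegral (γ₂, γ₁) f m = orbitalIntegral γ₂ (fun g₂ => f (g₂, γ₁)) (m.map e)` — a change of variables along the
measurable bijection `e`, no invariance and no integrability needed. [cite: Rogawski1990, §4.9 p. 54] [cite: Gelbart1975, §10 p. 155 (10.19)] -/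
theorem orbitalIntegral_pair_eq_orbitalIntegral_slice_map_of_comm
    {E : Type*} [NormedAddCommGroup E] [NormedSpace ℝ E]
    (hcomm : ∀ a b : G₁, a * b = b * a) (γ₂ : G₂) (γ₁ : G₁)
    [MeasurableSpace ((G₂ × G₁) ⧸ Subgroup.centralizer ({(γ₂, γ₁)} : Set (G₂ × G₁)))]
    [BorelSpace ((G₂ × G₁) ⧸ Subgroup.centralizer ({(γ₂, γ₁)} : Set (G₂ × G₁)))]
    [MeasurableSpace (G₂ ⧸ Subgroup.centralizer ({γ₂} : Set G₂))] [BorelSpace (G₂ ⧸ Subgroup.centralizer ({γ₂} : Set G₂))]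
    (e : (G₂ × G₁) ⧸ Subgroup.centralizer ({(γ₂, γ₁)} : Set (G₂ × G₁)) ≃ₜ G₂ ⧸ Subgroup.centralizer ({γ₂} : Set G₂))
    (he : ∀ x : G₂ × G₁, e (QuotientGroup.mk x) = QuotientGroup.mk x.1) (f : G₂ × G₁ → E)
    (m : Measure ((G₂ × G₁) ⧸ Subgroup.centralizer ({(γ₂, γ₁)} : Set (G₂ × G₁)))) :
    orbitalIntegral (γ₂, γ₁) f m = orbitalIntegral γ₂ (fun g₂ : G₂ => f (g₂, γ₁)) (m.map e) := by
  rw [orbitalIntegral_eq_integral_descConj, orbitalIntegral_eq_integral_descConj]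
  have h := integral_map_equiv e.toMeasurableEquiv
    (descConj γ₂ (Subgroup.centralizer ({γ₂} : Set G₂)) (fun _ hg => Subgroup.mem_centralizer_singleton_iff.1 hg)
      (fun g₂ : G₂ => f (g₂, γ₁))) (μ := m)
  rw [Homeomorph.toMeasurableEquiv_coe] at h
  rw [h]
  refine integral_congr_ae (Filter.Eventually.of_forall fun y => ?_)
  induction y using QuotientGroup.induction_on with
  | H x =>
    change _ = descConj γ₂ (Subgroup.centralizer ({γ₂} : Set G₂)) (fun _ hg => Subgroup.mem_centralizer_singleton_iff.1 hg)
      (fun g₂ : G₂ => f (g₂, γ₁)) (e (QuotientGroup.mk x))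
    rw [he, descConj_pair_mk_eq_of_comm hcomm]

/-- **The converse reading — `O_{γ₂}^{m₂}(f(·, γ₁)) = O_{(γ₂, γ₁)}^{(e⁻¹)_* m₂}(f)`** for a measure `m₂` on `G₂ ⧸ C(γ₂)`.
[cite: Rogawski1990, §4.9 p. 54] [cite: Gelbart1975, §10 p. 155 (10.19)] -/
theorem orbitalIntegral_slice_eq_orbitalIntegral_pair_map_symm_of_comm
    {E : Type*} [NormedAddCommGroup E] [NormedSpace ℝ E]
    (hcomm : ∀ a b : G₁, a * b = b * a) (γ₂ : G₂) (γ₁ : G₁)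
    [MeasurableSpace ((G₂ × G₁) ⧸ Subgroup.centralizer ({(γ₂, γ₁)} : Set (G₂ × G₁)))]
    [BorelSpace ((G₂ × G₁) ⧸ Subgroup.centralizer ({(γ₂, γ₁)} : Set (G₂ × G₁)))]
    [MeasurableSpace (G₂ ⧸ Subgroup.centralizer ({γ₂} : Set G₂))] [BorelSpace (G₂ ⧸ Subgroup.centralizer ({γ₂} : Set G₂))]
    (e : (G₂ × G₁) ⧸ Subgroup.centralizer ({(γ₂, γ₁)} : Set (G₂ × G₁)) ≃ₜ G₂ ⧸ Subgroup.centralizer ({γ₂} : Set G₂))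
    (he : ∀ x : G₂ × G₁, e (QuotientGroup.mk x) = QuotientGroup.mk x.1) (f : G₂ × G₁ → E)
    (m₂ : Measure (G₂ ⧸ Subgroup.centralizer ({γ₂} : Set G₂))) :
    orbitalIntegral γ₂ (fun g₂ : G₂ => f (g₂, γ₁)) m₂ = orbitalIntegral (γ₂, γ₁) f (m₂.map e.symm) := by
  rw [orbitalIntegral_pair_eq_orbitalIntegral_slice_map_of_comm hcomm γ₂ γ₁ e he f, Measure.map_map e.measurable e.symm.measurable,
    e.self_comp_symm, Measure.map_id]

/-- **Invariant orbit measures pull back to invariant orbit measures**: if `m₂` on `G₂ ⧸ C(γ₂)` is `G₂`-invariant then `(e⁻¹)_* m₂` on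
`(G₂ × G₁) ⧸ C(γ₂, γ₁)` is `G₂ × G₁`-invariant (equivariance `apply_smul_eq_of_forall_apply_mk`). [cite: Gelbart1975, §10 p. 155 (10.19)] -/
theorem smulInvariantMeasure_map_symm_of_comm [IsTopologicalGroup G₂] [IsTopologicalGroup G₁]
    (γ₂ : G₂) (γ₁ : G₁)
    [MeasurableSpace ((G₂ × G₁) ⧸ Subgroup.centralizer ({(γ₂, γ₁)} : Set (G₂ × G₁)))]
    [BorelSpace ((G₂ × G₁) ⧸ Subgroup.centralizer ({(γ₂, γ₁)} : Set (G₂ × G₁)))]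
    [MeasurableSpace (G₂ ⧸ Subgroup.centralizer ({γ₂} : Set G₂))] [BorelSpace (G₂ ⧸ Subgroup.centralizer ({γ₂} : Set G₂))]
    (e : (G₂ × G₁) ⧸ Subgroup.centralizer ({(γ₂, γ₁)} : Set (G₂ × G₁)) ≃ₜ G₂ ⧸ Subgroup.centralizer ({γ₂} : Set G₂))
    (he : ∀ x : G₂ × G₁, e (QuotientGroup.mk x) = QuotientGroup.mk x.1)
    (m₂ : Measure (G₂ ⧸ Subgroup.centralizer ({γ₂} : Set G₂))) [SMulInvariantMeasure G₂ (G₂ ⧸ Subgroup.centralizer ({γ₂} : Set G₂)) m₂] :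
    SMulInvariantMeasure (G₂ × G₁) ((G₂ × G₁) ⧸ Subgroup.centralizer ({(γ₂, γ₁)} : Set (G₂ × G₁))) (m₂.map e.symm) := by
  refine ⟨fun g s hs => ?_⟩
  have hpre : MeasurableSet ((fun y => g • y) ⁻¹' s) := (measurable_const_smul g) hs
  rw [Measure.map_apply e.symm.measurable hs, Measure.map_apply e.symm.measurable hpre]
  -- `e⁻¹ ⁻¹' (g • ·)⁻¹' s = (g.1 • ·)⁻¹' (e⁻¹ ⁻¹' s)`
  have hset : (e.symm ⁻¹' ((fun y => g • y) ⁻¹' s)) = (fun z => g.1 • z) ⁻¹' (e.symm ⁻¹' s) := by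
    ext z
    simp only [Set.mem_preimage]
    have h1 : g • e.symm z = e.symm (g.1 • z) := by
      apply e.injective
      rw [apply_smul_eq_of_forall_apply_mk γ₂ γ₁ e he, Homeomorph.apply_symm_apply, Homeomorph.apply_symm_apply]
    rw [h1]
  rw [hset, SMulInvariantMeasure.measure_preimage_smul g.1 (e.symm.measurable hs)]

end Orbital

/-! ## §4 Conjugacy classes of `G₂ × G₁`: `ConjClasses (G₂ × G₁) ≃ ConjClasses G₂ × G₁` -/

section Classes

variable {G₂ G₁ : Type*} [Group G₂] [Group G₁]

/-- `(a₂, a₁) ∼ (b₂, b₁)` iff `a₂ ∼ b₂` and `a₁ = b₁`, for `G₁` commutative. [cite: Rogawski1990, §4.2] -/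
theorem isConj_pair_iff_of_comm (hcomm : ∀ a b : G₁, a * b = b * a) (a b : G₂ × G₁) :
    IsConj a b ↔ IsConj a.1 b.1 ∧ a.2 = b.2 := by
  rw [isConj_iff, isConj_iff]
  constructor
  · rintro ⟨c, hc⟩
    have h1 := congrArg Prod.fst hc
    have h2 := congrArg Prod.snd hc
    simp only [Prod.fst_mul, Prod.fst_inv, Prod.snd_mul, Prod.snd_inv] at h1 h2
    rw [hcomm c.2 a.2, mul_inv_cancel_right] at h2
    exact ⟨⟨c.1, h1⟩, h2⟩
  · rintro ⟨⟨c, hc⟩, h2⟩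
    refine ⟨(c, 1), Prod.ext ?_ ?_⟩
    · simpa using hc
    · simp [h2]

/-- **`ConjClasses (G₂ × G₁) ≃ ConjClasses G₂ × G₁`** over `ConjClasses.mk`, for `G₁` commutative: the classes of `H(L⁺) = U(Φ₂)(L⁺) × U(Φ₁)(L⁺)`
are the pairs (class of `U(Φ₂)(L⁺)`, element of `U(Φ₁)(L⁺)`). [cite: Rogawski1990, §4.2; §7.3 p. 98] -/
theorem exists_equiv_conjClasses_prod_of_comm (hcomm : ∀ a b : G₁, a * b = b * a) :
    ∃ E : ConjClasses (G₂ × G₁) ≃ ConjClasses G₂ × G₁, ∀ x : G₂ × G₁, E (ConjClasses.mk x) = (ConjClasses.mk x.1, x.2) := by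
  classical
  -- the forward map on representatives respects conjugacy
  let F : G₂ × G₁ → ConjClasses G₂ × G₁ := fun x => (ConjClasses.mk x.1, x.2)
  have hF : ∀ a b : G₂ × G₁, IsConj a b → F a = F b := by
    intro a b hab
    obtain ⟨h1, h2⟩ := (isConj_pair_iff_of_comm hcomm a b).1 hab
    exact Prod.ext (ConjClasses.mk_eq_mk_iff_isConj.2 h1) h2
  let Φ : ConjClasses (G₂ × G₁) → ConjClasses G₂ × G₁ :=
    fun c => Quotient.liftOn' c F fun a b hab => hF a b hab
  have hΦ : ∀ x : G₂ × G₁, Φ (ConjClasses.mk x) = F x := fun x => rfl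
  have hbij : Function.Bijective Φ := by
    constructor
    · intro c c' h
      obtain ⟨a, rfl⟩ := ConjClasses.mk_surjective c
      obtain ⟨b, rfl⟩ := ConjClasses.mk_surjective c'
      rw [hΦ, hΦ] at h
      obtain ⟨h1, h2⟩ := Prod.ext_iff.1 h
      exact ConjClasses.mk_eq_mk_iff_isConj.2
        ((isConj_pair_iff_of_comm hcomm a b).2 ⟨ConjClasses.mk_eq_mk_iff_isConj.1 h1, h2⟩)
    · rintro ⟨c₂, x₁⟩
      obtain ⟨a₂, rfl⟩ := ConjClasses.mk_surjective c₂
      exact ⟨ConjClasses.mk (a₂, x₁), by rw [hΦ]⟩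
  exact ⟨Equiv.ofBijective Φ hbij, fun x => hΦ x⟩

end Classes

/-! ## §5 At the kit's carriers: `H(𝔸) = U(H₂)(𝔸) × U(H₁)(𝔸)` with `U(H₁)` COMMUTATIVE (`H₁ ∈ M₁(L)`) -/

section Kit

variable (L : Type) [Field L] [NumberField L] [IsCMField L] {N : ℕ} (H₂ : Matrix (Fin N) (Fin N) L) (H₁ : Matrix (Fin 1) (Fin 1) L)

/-- **The slice formula on `U(H₂)(𝔸) × U(H₁)(𝔸)`** (`U(H₁)(𝔸)` commutative, ★ `cmDatum_one_mul_comm`): for every slice homeomorphism `e` of §2,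
`O_{(γ₂, γ₁)}^m(f^H) = O_{γ₂}^{e_* m}(f^H(·, γ₁))` — the orbital integrals of the endoscopic group `H = U(2) × U(1)` are orbital integrals on
`U(2)`. [cite: Rogawski1990, §4.2; §4.9 p. 54; §7.3 p. 98] -/
theorem UnitaryGroup.orbitalIntegral_pair_eq_orbitalIntegral_slice_map_cmDatum_one
    (γ₂ : (UnitaryGroup.cmDatum L N H₂).Adelic) (γ₁ : (UnitaryGroup.cmDatum L 1 H₁).Adelic)
    [MeasurableSpace (((UnitaryGroup.cmDatum L N H₂).Adelic × (UnitaryGroup.cmDatum L 1 H₁).Adelic) ⧸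
      Subgroup.centralizer ({(γ₂, γ₁)} : Set ((UnitaryGroup.cmDatum L N H₂).Adelic × (UnitaryGroup.cmDatum L 1 H₁).Adelic)))]
    [BorelSpace (((UnitaryGroup.cmDatum L N H₂).Adelic × (UnitaryGroup.cmDatum L 1 H₁).Adelic) ⧸
      Subgroup.centralizer ({(γ₂, γ₁)} : Set ((UnitaryGroup.cmDatum L N H₂).Adelic × (UnitaryGroup.cmDatum L 1 H₁).Adelic)))]
    [MeasurableSpace ((UnitaryGroup.cmDatum L N H₂).Adelic ⧸ Subgroup.centralizer ({γ₂} : Set (UnitaryGroup.cmDatum L N H₂).Adelic))]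
    [BorelSpace ((UnitaryGroup.cmDatum L N H₂).Adelic ⧸ Subgroup.centralizer ({γ₂} : Set (UnitaryGroup.cmDatum L N H₂).Adelic))]
    (e : ((UnitaryGroup.cmDatum L N H₂).Adelic × (UnitaryGroup.cmDatum L 1 H₁).Adelic) ⧸
        Subgroup.centralizer ({(γ₂, γ₁)} : Set ((UnitaryGroup.cmDatum L N H₂).Adelic × (UnitaryGroup.cmDatum L 1 H₁).Adelic)) ≃ₜ
      (UnitaryGroup.cmDatum L N H₂).Adelic ⧸ Subgroup.centralizer ({γ₂} : Set (UnitaryGroup.cmDatum L N H₂).Adelic))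
    (he : ∀ x, e (QuotientGroup.mk x) = QuotientGroup.mk x.1)
    (f : (UnitaryGroup.cmDatum L N H₂).Adelic × (UnitaryGroup.cmDatum L 1 H₁).Adelic → ℂ)
    (m : Measure (((UnitaryGroup.cmDatum L N H₂).Adelic × (UnitaryGroup.cmDatum L 1 H₁).Adelic) ⧸
      Subgroup.centralizer ({(γ₂, γ₁)} : Set ((UnitaryGroup.cmDatum L N H₂).Adelic × (UnitaryGroup.cmDatum L 1 H₁).Adelic)))) :
    orbitalIntegral (γ₂, γ₁) f m = orbitalIntegral γ₂ (fun g₂ => f (g₂, γ₁)) (m.map e) :=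
  orbitalIntegral_pair_eq_orbitalIntegral_slice_map_of_comm (UnitaryGroup.cmDatum_one_mul_comm L H₁) γ₂ γ₁ e he f m

/-- The slice homeomorphism EXISTS at the kit's carriers. [cite: Rogawski1990, §4.2] -/
theorem UnitaryGroup.exists_homeomorph_quotient_centralizer_pair_cmDatum_one
    (γ₂ : (UnitaryGroup.cmDatum L N H₂).Adelic) (γ₁ : (UnitaryGroup.cmDatum L 1 H₁).Adelic) :
    ∃ e : ((UnitaryGroup.cmDatum L N H₂).Adelic × (UnitaryGroup.cmDatum L 1 H₁).Adelic) ⧸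
        Subgroup.centralizer ({(γ₂, γ₁)} : Set ((UnitaryGroup.cmDatum L N H₂).Adelic × (UnitaryGroup.cmDatum L 1 H₁).Adelic)) ≃ₜ
      (UnitaryGroup.cmDatum L N H₂).Adelic ⧸ Subgroup.centralizer ({γ₂} : Set (UnitaryGroup.cmDatum L N H₂).Adelic),
      ∀ x, e (QuotientGroup.mk x) = QuotientGroup.mk x.1 :=
  exists_homeomorph_quotient_centralizer_pair_of_comm (UnitaryGroup.cmDatum_one_mul_comm L H₁) γ₂ γ₁

end Kit

end Literature.NumberTheory.Automorphic

end
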